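import Summits.ResolutionOfSingularities.ResolutionOfSingularities.Theorems.MarkedTransferCampaignW46WWalkSubst
import Summits.ResolutionOfSingularities.ResolutionOfSingularities.Theorems.WildConesCampaignW46FormalChartAssembly
import Summits.ResolutionOfSingularities.ResolutionOfSingularities.Theorems.WildConesCampaignW46AtomChartOrder
import Literature.RingTheory.MvPowerSeries.MaximalIdealPow
import HarnessLib

/-!
# [OURS · L1 W4.6 rung (iii-2)] THE W-WALK: the FORMAL STEP for a GENERAL window germ `z^p + f` (ring level) — the controlled
# transform at a singular point of the point blow-up is `w′ · (z^p + chartT p l f)` in Cohen coordinates, and the `z`-translation of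
# the point VANISHES

Cell `res-hironaka`, LADDER-RESOLUTION rung L (D-0089), slot W4.6 rung (iii); seat res-L1-s46-pv-5 (gen 6), plan
`HOME/L/res-L1-s46-pv-5/W-WALK-PLAN.md` §3 [E] / §4. Host route MarkedTransfer, `--supports stmt-ResolutionOfSingularities-16155 --as helper`;
kind proof (def-free). Template: res-L1-s46-pv-6 `…MohWindowShadeFormalInsepStepCore.exists_ringEquiv_transform_seriesAnchor` (purely
inseparable residuals `F(u)`); here the residual `f ∈ K⟦t,y,z⟧` is ARBITRARY of order `≥ p + 1` (the cleaned inherited presentation).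

WHAT. Ring-level data of a point blow-up at a residually rational point (pv-2's dictionary: `g : R → L` local, Cohen coordinates `E₀` of `R̂`
adapted to an r.s.p. `c` to first order, chart data `(i₀, e, τ)` of `L`, `hres`, `hdim`), a window germ `E₀(f₀) = w₀ · (z^p + f)` with
`ord f ≥ p + 1`, and its controlled transform `f′` (`g f₀ = g(c_{i₀})^p f′`) at a SINGULAR point (`f′ ∈ 𝔪_L^p`). THEN
(`exists_ringEquiv_transform_wAnchor`): the `z`-coordinate of the point is `0` (its `p`-th power is the constant term of the transform), and
there are Cohen coordinates `E′` of `L̂` with `E′(f′) = w′ · G`, `w′` a unit, `X_{i₀}^p · G = (z^p + f) ∘ Θ` for the chart substitution `Θ`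
of the point with `z`-translation `0`; in the `t`-chart (`i₀ = 0`) this reads `E′(f′) = w′ · (z^p + chartT p l f)` with `l` the
`y`-coordinate of the point (`exists_ringEquiv_transform_wAnchor_T`, via `…WWalkSubst.subst_thetaT_generator`).

HONEST FRAMING. OURS; nothing here is a statement of H. Hironaka's manuscript [Hironaka2017] and nothing of it is used. AI-written;
AI review is weaker than expert review. No `sorry`; axioms standard. [cite: Matsumura1987, Thm. 8.11] for completions; chart calculus
[Hauser2010] §§F–G.
-/

noncomputable section

set_option linter.dupNamespace false -- mandated namespace of this single-conjunct summit

open MvPowerSeries IsLocalRing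
open Literature.AlgebraicGeometry.Resolution
open Literature.RingTheory.MvPowerSeries.Jets (mem_maximalIdeal_iff_constantCoeff_eq_zero)

namespace Summit.ResolutionOfSingularities.ResolutionOfSingularities.Theorems

namespace CampaignW46

namespace WWalk

open CampaignW46.FormalChart
open CampaignW46.AtomGerm (exists_isUnit_image_adapted X_some_ne_zero mem_maximalIdeal_pow_iff_algebraMap subst_mem_pow_of_mem_maximalIdeal_pow)

section Transform

variable {p : ℕ} [hp : Fact p.Prime] {K : Type} [Field K]
  {R : Type} [CommRing R] [IsLocalRing R] [IsNoetherianRing R]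
  {L : Type} [CommRing L] [IsLocalRing L] [IsNoetherianRing L]
  (g : R →+* L) (hg : (maximalIdeal R).map g ≤ maximalIdeal L)
  (E₀ : AdicCompletion (maximalIdeal R) R ≃+* MvPowerSeries (Option (Fin 2)) K)
  (c : Option (Fin 2) → R) (hc : Ideal.span (Set.range c) = maximalIdeal R)
  (hcX : ∀ j, E₀ (algebraMap R (AdicCompletion (maximalIdeal R) R) (c j)) - MvPowerSeries.X j ∈
    maximalIdeal (MvPowerSeries (Option (Fin 2)) K) ^ 2)
  (i₀ : Fin 2) (e : Option (Fin 2) → L) (he : ∀ j, g (c j) = g (c (some i₀)) * e j)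
  (τ : Option (Fin 2) → R)
  (hgen : Ideal.span (Set.range fun j : Option (Fin 2) =>
    if j = some i₀ then g (c (some i₀)) else e j - g (τ j)) = maximalIdeal L)
  (hres : ∀ y : L, ∃ r : R, y - g r ∈ maximalIdeal L)
  (hdim : (Fintype.card (Option (Fin 2)) : WithBot ℕ∞) ≤ ringKrullDim L)

include hg hc he hcX hgen hres hdim in
/-- **THE FORMAL STEP FOR A GENERAL WINDOW GERM (ring level).** See the module docstring: at a singular point of the transform the
`z`-translation vanishes and `E′(f′) = w′ · G` with `X_{i₀}^p · G = (z^p + f)(Θ)`, `Θ` the chart substitution of the point with `z`-translation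
`0`. [cite: Matsumura1987, Thm. 8.11] [cite: Hauser2010, §§F–G] -/
theorem exists_ringEquiv_transform_wAnchor (f : MvPowerSeries (Option (Fin 2)) K) (hfP2 : LowVanish (p + 1) f) (f₀ : R)
    (w₀ : MvPowerSeries (Option (Fin 2)) K) (hw₀ : IsUnit w₀)
    (hf₀ : E₀ (algebraMap R (AdicCompletion (maximalIdeal R) R) f₀) = w₀ * (MvPowerSeries.X none ^ p + f))
    (f' : L) (hf' : g f₀ = g (c (some i₀)) ^ p * f') (hf'𝔪 : f' ∈ maximalIdeal L ^ p) :
    MvPowerSeries.constantCoeff (E₀ (algebraMap R (AdicCompletion (maximalIdeal R) R) (τ none))) = 0 ∧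
    ∃ (E' : AdicCompletion (maximalIdeal L) L ≃+* MvPowerSeries (Option (Fin 2)) K) (w' G : MvPowerSeries (Option (Fin 2)) K),
      IsUnit w' ∧ E' (algebraMap L (AdicCompletion (maximalIdeal L) L) f') = w' * G ∧
      MvPowerSeries.X (some i₀) ^ p * G = MvPowerSeries.subst (fun j : Option (Fin 2) => if j = some i₀ then (X (some i₀) : MvPowerSeries (Option (Fin 2)) K)
        else X (some i₀) * (X j + MvPowerSeries.C (if j = none then 0 else
          MvPowerSeries.constantCoeff (E₀ (algebraMap R (AdicCompletion (maximalIdeal R) R) (τ j)))))) (MvPowerSeries.X none ^ p + f) := by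
  classical
  set ĝ := adicCompletionMap (maximalIdeal R) (maximalIdeal L) g hg with hĝ
  set φ : (MvPowerSeries (Option (Fin 2)) K) →+* AdicCompletion (maximalIdeal L) L := ĝ.comp E₀.symm.toRingHom with hφ
  set ofL := algebraMap L (AdicCompletion (maximalIdeal L) L) with hofL
  set ofR := algebraMap R (AdicCompletion (maximalIdeal R) R) with hofR
  set τκ : Option (Fin 2) → K := fun j => MvPowerSeries.constantCoeff (E₀ (ofR (τ j))) with hτκ
  have hφE₀ : ∀ x, φ (E₀ x) = ĝ x := fun x => by
    rw [hφ, RingHom.comp_apply]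
    change ĝ (E₀.symm (E₀ x)) = ĝ x
    rw [RingEquiv.symm_apply_apply]
  have hĝ_of : ∀ x : R, ĝ (ofR x) = ofL (g x) := fun x => by
    rw [hofR, hofL, hĝ, adicCompletionMap_algebraMap]
  haveI : IsNoetherianRing (AdicCompletion (maximalIdeal L) L) := isNoetherianRing_adicCompletion_maximalIdeal L
  -- STEP 1: the chart `E'` of `L̂`
  obtain ⟨E', hE'C, hE'i, hE'j⟩ := exists_ringEquiv_completion_chart g hg E₀ c hc hcX (some i₀) e he τ hgen hres hdim
  set ψ : (MvPowerSeries (Option (Fin 2)) K) →+* (MvPowerSeries (Option (Fin 2)) K) := (E' : _ →+* (MvPowerSeries (Option (Fin 2)) K)).comp φ with hψ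
  have hψapp : ∀ x, ψ x = E' (φ x) := fun x => rfl
  have hψC : ∀ l, ψ (MvPowerSeries.C l) = MvPowerSeries.C l := fun l => hE'C l
  have hψi : ψ (X (some i₀)) = X (some i₀) := hE'i
  have hψj : ∀ j, j ≠ some i₀ → ψ (X j) = X (some i₀) * (X j + MvPowerSeries.C (τκ j)) := fun j hj => hE'j j hj
  -- the chart substitution family (with the `z`-translation `ζ = τκ none`)
  set Θ : Option (Fin 2) → MvPowerSeries (Option (Fin 2)) K := fun j => if j = some i₀ then (X (some i₀) : MvPowerSeries (Option (Fin 2)) K)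
    else X (some i₀) * (X j + MvPowerSeries.C (τκ j)) with hΘ
  have hΘsub : HasSubst Θ := hasSubst_chart (some i₀) τκ
  have hψsubst : ∀ h, ψ h = subst Θ h := fun h => ringHom_eq_subst_of_apply_X ψ hψC (some i₀) τκ hψi hψj h
  have hΘi : Θ (some i₀) = X (some i₀) := by rw [hΘ]; exact if_pos rfl
  have hΘmem : ∀ j, Θ j ∈ Ideal.span {(X (some i₀) : MvPowerSeries (Option (Fin 2)) K)} := by
    intro j
    by_cases hj : j = some i₀
    · rw [hj, hΘi]; exact Ideal.subset_span rfl
    · rw [hΘ]; simp only [if_neg hj]; exact Ideal.mul_mem_right _ _ (Ideal.subset_span rfl)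
  -- STEP 2: `subst Θ f ∈ (X_{i₀}^{p+1})`: write it as `X_{i₀}^{p+1} · H`
  have hfmem : f ∈ maximalIdeal (MvPowerSeries (Option (Fin 2)) K) ^ (p + 1) :=
    (Literature.RingTheory.MvPowerSeries.Jets.mem_maximalIdeal_pow_iff).mpr hfP2
  obtain ⟨H, hH⟩ : ∃ H : MvPowerSeries (Option (Fin 2)) K, subst Θ f = X (some i₀) ^ (p + 1) * H := by
    have h := subst_mem_pow_of_mem_maximalIdeal_pow hΘsub hΘmem hfmem
    rw [Ideal.span_singleton_pow] at h
    exact Ideal.mem_span_singleton'.1 h |>.imp fun H hH => by rw [← hH, mul_comm]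
  -- the transform bracket `G₁ = (X_z + ζ)^p + X_{i₀} H` with `ψ (z^p + f) = X_{i₀}^p G₁`
  set G₁ : MvPowerSeries (Option (Fin 2)) K := (X none + MvPowerSeries.C (τκ none)) ^ p + X (some i₀) * H with hG₁
  have hψzf : ψ (MvPowerSeries.X none ^ p + f) = X (some i₀) ^ p * G₁ := by
    rw [map_add, map_pow, hψj none (Option.some_ne_none i₀).symm, hψsubst f, hH, hG₁, mul_pow]
    ring
  have hEgf₀ : E' (ofL (g f₀)) = ψ w₀ * (X (some i₀) ^ p * G₁) := by
    rw [← hĝ_of, ← hφE₀, ← hψapp, hf₀, map_mul, hψzf]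
  -- STEP 3: `E′ (g c_{i₀}) = X_{i₀} · unit`
  obtain ⟨w₂, hw₂, hEci⟩ : ∃ w₂ : MvPowerSeries (Option (Fin 2)) K, IsUnit w₂ ∧ E' (ofL (g (c (some i₀)))) = X (some i₀) * w₂ := by
    obtain ⟨w₂, hw₂, h⟩ := exists_isUnit_image_adapted i₀ hΘsub hΘi hΘmem (E₀ (ofR (c (some i₀)))) (hcX (some i₀))
    exact ⟨w₂, hw₂, by rw [← hĝ_of, ← hφE₀, ← hψapp, hψsubst, h]⟩
  have hw₀' : IsUnit (ψ w₀) := hw₀.map ψ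
  -- STEP 4: cancel `X_{i₀}^p`: `w₂^p · E′ f′ = ψ(w₀) · G₁`
  have hEf' : w₂ ^ p * E' (ofL f') = ψ w₀ * G₁ := by
    have h1 : E' (ofL (g f₀)) = (X (some i₀) * w₂) ^ p * E' (ofL f') := by
      rw [hf', map_mul, map_pow, map_mul, map_pow, hEci]
    have h2 : (X (some i₀) : MvPowerSeries (Option (Fin 2)) K) ^ p * (w₂ ^ p * E' (ofL f')) = X (some i₀) ^ p * (ψ w₀ * G₁) := by
      rw [← mul_assoc, ← mul_pow, ← h1, hEgf₀]; ring
    exact mul_left_cancel₀ (pow_ne_zero p (X_some_ne_zero i₀)) h2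
  -- STEP 5: singularity upstairs forces `ζ = 0`
  have hG𝔪 : G₁ ∈ maximalIdeal (MvPowerSeries (Option (Fin 2)) K) ^ p := by
    have h1 : E' (ofL f') ∈ maximalIdeal (MvPowerSeries (Option (Fin 2)) K) ^ p :=
      ringEquiv_mem_maximalIdeal_pow E' ((mem_maximalIdeal_pow_iff_algebraMap p f').mp hf'𝔪)
    have h2 : ψ w₀ * G₁ ∈ maximalIdeal (MvPowerSeries (Option (Fin 2)) K) ^ p := by rw [← hEf']; exact Ideal.mul_mem_left _ _ h1
    exact (Ideal.unit_mul_mem_iff_mem _ hw₀').mp h2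
  have hζ0 : τκ none = 0 := by
    have hG0 : MvPowerSeries.constantCoeff G₁ = 0 :=
      mem_maximalIdeal_iff_constantCoeff_eq_zero.mp (Ideal.pow_le_self hp.out.ne_zero hG𝔪)
    rw [hG₁, map_add, map_pow, map_add, MvPowerSeries.constantCoeff_X, zero_add, MvPowerSeries.constantCoeff_C, map_mul,
      MvPowerSeries.constantCoeff_X, zero_mul, add_zero] at hG0
    exact (pow_eq_zero_iff hp.out.ne_zero).mp hG0
  -- assemble
  obtain ⟨u₂, hu₂⟩ := hw₂.pow p
  refine ⟨hζ0, E', ↑u₂⁻¹ * ψ w₀, G₁, (u₂⁻¹.isUnit).mul hw₀', ?_, ?_⟩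
  · rw [mul_assoc, ← hEf', ← hu₂, ← mul_assoc, Units.inv_mul, one_mul]
  · rw [← hψzf, hψsubst]
    congr 1
    funext j
    by_cases hj : j = some i₀
    · rw [hj, hΘi, if_pos rfl]
    · rw [hΘ]
      simp only [if_neg hj]
      by_cases hjn : j = none
      · rw [hjn, if_pos rfl, hζ0]
      · rw [if_neg hjn]

include hg hc he hcX hgen hres hdim in
/-- **THE FORMAL `T`-STEP** (chart `t = X (some 0)`): at a singular point of the transform in the `t`-chart, `E′(f′) = w′ · (z^p + chartT p l f)`
with `l` the `y`-coordinate of the point (and the `z`-coordinate is `0`). [cite: Matsumura1987, Thm. 8.11] [cite: Hauser2010, §§F–G] -/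
theorem exists_ringEquiv_transform_wAnchor_T (hi₀ : i₀ = 0) (f : MvPowerSeries (Option (Fin 2)) K) (hfP2 : LowVanish (p + 1) f) (f₀ : R)
    (w₀ : MvPowerSeries (Option (Fin 2)) K) (hw₀ : IsUnit w₀)
    (hf₀ : E₀ (algebraMap R (AdicCompletion (maximalIdeal R) R) f₀) = w₀ * (MvPowerSeries.X none ^ p + f))
    (f' : L) (hf' : g f₀ = g (c (some i₀)) ^ p * f') (hf'𝔪 : f' ∈ maximalIdeal L ^ p) :
    ∃ (E' : AdicCompletion (maximalIdeal L) L ≃+* MvPowerSeries (Option (Fin 2)) K) (w' : MvPowerSeries (Option (Fin 2)) K),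
      IsUnit w' ∧ E' (algebraMap L (AdicCompletion (maximalIdeal L) L) f') =
        w' * (MvPowerSeries.X none ^ p + chartT p (MvPowerSeries.constantCoeff (E₀ (algebraMap R (AdicCompletion (maximalIdeal R) R) (τ (some 1))))) f) := by
  subst hi₀
  obtain ⟨-, E', w', G, hw', hE', hG⟩ := exists_ringEquiv_transform_wAnchor g hg E₀ c hc hcX 0 e he τ hgen hres hdim f hfP2 f₀ w₀ hw₀ hf₀ f' hf' hf'𝔪
  set l : K := MvPowerSeries.constantCoeff (E₀ (algebraMap R (AdicCompletion (maximalIdeal R) R) (τ (some 1)))) with hl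
  have hfam : (fun j : Option (Fin 2) => if j = some (0 : Fin 2) then (X (some 0) : MvPowerSeries (Option (Fin 2)) K)
      else X (some 0) * (X j + MvPowerSeries.C (if j = none then 0 else
        MvPowerSeries.constantCoeff (E₀ (algebraMap R (AdicCompletion (maximalIdeal R) R) (τ j)))))) = thetaT l := by
    funext j
    rcases j with _ | k
    · simp
    · fin_cases k
      · simp
      · simp [hl]
  rw [hfam, subst_thetaT_generator l (fun e he => hfP2 e (by omega))] at hG
  refine ⟨E', w', hw', ?_⟩
  rw [hE', mul_left_cancel₀ (pow_ne_zero p (X_some_ne_zero (0 : Fin 2))) hG]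

end Transform

end WWalk

end CampaignW46

end Summit.ResolutionOfSingularities.ResolutionOfSingularities.Theorems

end
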